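import Summits.RiemannHypothesis.Statement
import Summits.RiemannHypothesis.RiemannHypothesis.Theorems.UniversalFactorLaguerreLiftStandalone
import Literature.NumberTheory.LFunctions.DeBruijnNewmanConstProofs

/-!
# RiemannHypothesis / UniversalFactor — `Assembly` (`LaplaceLoophole → RH`), route-file-independent

Route `RiemannHypothesis/UniversalFactor` (Cardon's loophole), item **`Assembly`**
(stmt-RiemannHypothesis-13912, formerly stmt-RiemannHypothesis-2584): with `Φ = deBruijnPhi` and, for
`a > 0`, the Laplace-smoothed de Bruijn transform
`F_a(z) = ∫₀^∞ Φ(u) (1 + u²/a²)⁻¹ cos(zu) du` (`= deBruijnHDiv (fun u ↦ 1 + u²/a²) z` by `rfl`),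
the loophole `LaplaceLoophole` ("for some `a > 0`, `F_a` has only real zeros") implies the Riemann
hypothesis: a real-rooted `F_a` lifts through `1 − D²/a²` to a real-rooted
`H_0 = F_a − F_a''/a² = ξ(1/2 + iz/2)/8` (the Laguerre lift,
`UniversalFactorStandalone.laguerreLift` of `UniversalFactorLaguerreLiftStandalone.lean`), and `H_0`
real-rooted is RH (`riemannHypothesis_iff_hasOnlyRealZeros_deBruijnH_zero_holds`, proved in tree).

The same theorem is `UniversalFactor.assembly` of `UniversalFactorLaguerreLift.lean`, but that module
imports the route file `Theses/UniversalFactor.lean`, into which the gate writes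
`import <proving module>` + `theorem Assembly_holds` when the item is closed — an import cycle (route
revs 3/5). This module imports neither the route file nor any module importing it, and
`UniversalFactorStandalone.assembly` states the BODY of the route decl `Assembly` verbatim (with
`LaplaceLoophole` unfolded), so that `example : UniversalFactor.Assembly := by exact
UniversalFactorStandalone.assembly` elaborates (checked 2026-08-16) and the item can be closed `--by` it
— the device of `UniversalFactorStandalone.wideKernelNoGo` / `.laguerreLift`.

Nothing here decides `LaplaceLoophole` itself (expected false: cruxes `NarrowKernelNoGo`,
`MediumKernelNoGo`, `WideKernelNoGo`, `ExceptionalWideNoGo`).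

References: D. A. Cardon, Proc. AMS 130 (2002), §3 Question 7; N. G. de Bruijn, Duke Math. J. 17
(1950), Thm. 10; E. C. Titchmarsh, *The theory of the Riemann zeta-function* (1986), §10.1.
-/

noncomputable section

namespace Summit.RiemannHypothesis.RiemannHypothesis.Theorems

open Literature.NumberTheory.LFunctions

/-- **`Assembly`** (the body of the route decl, verbatim; item stmt-RiemannHypothesis-13912): if for
some `a > 0` the Laplace-smoothed transform `F_a(z) = ∫₀^∞ Φ(u)(1 + u²/a²)⁻¹ cos(zu) du` has only
real zeros, then the Riemann hypothesis holds. Proof: the hypothesis is literally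
`HasOnlyRealZeros (deBruijnHDiv (fun u ↦ 1 + u²/a²))` (`deBruijnHDiv` unfolds to the inline
integral), so `UniversalFactorStandalone.laguerreLift` gives `HasOnlyRealZeros (deBruijnH 0)`, which
is `RiemannHypothesis` by `riemannHypothesis_iff_hasOnlyRealZeros_deBruijnH_zero_holds` and
`Summit.RiemannHypothesis_iff`. [folklore] -/
theorem UniversalFactorStandalone.assembly :
    (∃ a : ℝ, 0 < a ∧ Literature.NumberTheory.LFunctions.HasOnlyRealZeros (fun z : ℂ =>
      ∫ u in Set.Ioi (0:ℝ), ((Literature.NumberTheory.LFunctions.deBruijnPhi u / (1 + u ^ 2 / a ^ 2)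
        : ℝ) : ℂ) * Complex.cos (z * u))) →
      _root_.Summit.RiemannHypothesis := fun ⟨a, ha, h⟩ ↦
  _root_.Summit.RiemannHypothesis_iff.mpr
    (riemannHypothesis_iff_hasOnlyRealZeros_deBruijnH_zero_holds.mpr
      (UniversalFactorStandalone.laguerreLift a ha h))

end Summit.RiemannHypothesis.RiemannHypothesis.Theorems
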